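import Summits.AnomalousDissipation.AnomalousDissipation.Theorems.MarginalStabilityChainBurgersLayerLowReGreenUnique

/-!
# Route MarginalStabilityChain · BurgersLayerLowRe — the integrated mode equation and the coupling

Helper file (supports stmt-AnomalousDissipation-3010, `BurgersLayerLowRe`).

* `integral_mode_eq` — integrating `σω = −ia(Uω + U₂ψ) + ω + yω' + ω'' − α²ω` over the line gives the
  MASS IDENTITY `(σ + α²)∫ω = −ia ∫(Uω + U₂ψ)` (`∫yω' = −∫ω`, `∫ω'' = 0`);
* `coupling_integral_eq` — with `ψ = Tω` (Green potential of the vorticity) and `V = TU`,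
  `∫(Uω + U''ψ) = α²∫Vω`, by the symmetry of `T` and `T(U'') = α²TU − U`;

Folklore manipulations; the combination (mass identity + parity) is what makes the low-Reynolds-number
stability of the Burgers layer UNIFORM in the wavenumber.
-/

noncomputable section

open MeasureTheory Set Filter Topology
open scoped Real RealInnerProductSpace Interval

namespace Summit.AnomalousDissipation.AnomalousDissipation.Theorems.MarginalStabilityChainBurgersLayerLowRe

-- the summit and its single sub-problem share the name `AnomalousDissipation` (tree layout D-0017)
set_option linter.dupNamespace false

open Literature.Analysis.ODE

/-! ### The integrated mode equation (mass identity) and the coupling integral -/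

section Mass

variable {α : ℝ}

/-- **Integrated mode equation.** Integrating `σω = −ia(Uω + U₂ψ) + ω + yω' + ω'' − α²ω` over the line
(`∫ yω' = −∫ ω`, `∫ ω'' = 0`) gives `(σ + α²) ∫ω = −ia ∫(Uω + U₂ψ)`. [folklore] -/
theorem integral_mode_eq {σ : ℂ} {a al : ℝ} {ω ω' ω'' ψ : ℝ → ℂ} {U U₂ : ℝ → ℝ}
    (hω : ∀ y, HasDerivAt ω (ω' y) y) (hω' : ∀ y, HasDerivAt ω' (ω'' y) y)
    (iω : Integrable ω) (iF : Integrable fun y => (U y : ℂ) * ω y + (U₂ y : ℂ) * ψ y)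
    (iyω' : Integrable fun y : ℝ => (y : ℂ) * ω' y) (iyω : Integrable fun y : ℝ => (y : ℂ) * ω y)
    (iω' : Integrable ω') (iω'' : Integrable ω'')
    (heq : ∀ y, σ * ω y = -(Complex.I * a) * ((U y : ℂ) * ω y + (U₂ y : ℂ) * ψ y) + ω y + y * ω' y + ω'' y -
      (al : ℂ) ^ 2 * ω y) :
    (σ + (al : ℂ) ^ 2) * ∫ y, ω y = -(Complex.I * a) * ∫ y, ((U y : ℂ) * ω y + (U₂ y : ℂ) * ψ y) := by
  -- `∫ y ω' = -∫ ω`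
  have h1 : ∫ y : ℝ, (y : ℂ) * ω' y = -∫ y, ω y := by
    have i1 : Integrable ((fun _ : ℝ => (1 : ℂ)) * ω) := iω.congr (Eventually.of_forall fun y => (one_mul (ω y)).symm)
    have h := integral_mul_deriv_eq_deriv_mul_of_integrable (u := fun y : ℝ => (y : ℂ)) (v := ω) (u' := fun _ => 1)
      (v' := ω') (fun y _ => by simpa using (hasDerivAt_id y).ofReal_comp) (fun y _ => hω y) iyω' i1 iyω
    simpa using h
  -- `∫ ω'' = 0`
  have h2 : ∫ y, ω'' y = 0 := by
    have i1 : Integrable ((fun _ : ℝ => (1 : ℂ)) * ω'') := iω''.congr (Eventually.of_forall fun y => (one_mul (ω'' y)).symm)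
    have i2 : Integrable ((fun _ : ℝ => (0 : ℂ)) * ω') :=
      (integrable_zero ℝ ℂ volume).congr (Eventually.of_forall fun y => (zero_mul (ω' y)).symm)
    have i3 : Integrable ((fun _ : ℝ => (1 : ℂ)) * ω') := iω'.congr (Eventually.of_forall fun y => (one_mul (ω' y)).symm)
    have h := integral_mul_deriv_eq_deriv_mul_of_integrable (u := fun _ : ℝ => (1 : ℂ)) (v := ω') (u' := fun _ => 0)
      (v' := ω'') (fun y _ => hasDerivAt_const y (1 : ℂ)) (fun y _ => hω' y) i1 i2 i3
    simpa using h
  -- integrate the equation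
  have i1 : Integrable fun y => -(Complex.I * a) * ((U y : ℂ) * ω y + (U₂ y : ℂ) * ψ y) := iF.const_mul _
  have i2 : Integrable fun y => -(Complex.I * a) * ((U y : ℂ) * ω y + (U₂ y : ℂ) * ψ y) + ω y := i1.add iω
  have i3 : Integrable fun y => -(Complex.I * a) * ((U y : ℂ) * ω y + (U₂ y : ℂ) * ψ y) + ω y + (y : ℂ) * ω' y :=
    i2.add iyω'
  have i4 : Integrable fun y => -(Complex.I * a) * ((U y : ℂ) * ω y + (U₂ y : ℂ) * ψ y) + ω y + (y : ℂ) * ω' y + ω'' y :=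
    i3.add iω''
  have i5 : Integrable fun y => (al : ℂ) ^ 2 * ω y := iω.const_mul _
  have hint : ∫ y, σ * ω y = ∫ y, (-(Complex.I * a) * ((U y : ℂ) * ω y + (U₂ y : ℂ) * ψ y) + ω y + (y : ℂ) * ω' y +
      ω'' y - (al : ℂ) ^ 2 * ω y) := integral_congr_ae (Eventually.of_forall heq)
  rw [integral_const_mul, integral_sub i4 i5, integral_add i3 iω'', integral_add i2 iyω', integral_add i1 iω,
    integral_const_mul, integral_const_mul, h1, h2] at hint
  linear_combination hint

/-- **The coupling integral.** With `ψ = Tω` the Green potential of the vorticity and `V = TU` that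
of the (bounded, `C²`) profile `U` with `U'' = U₂` bounded and integrable,
`∫ (Uω + U₂ψ) = α² ∫ V ω`: by the symmetry of `T`, `∫ U₂ · Tω = ∫ T(U₂) · ω`, and
`T(U₂) = α² TU − U` since `U` is the bounded solution of `g'' = α²g − (α²U − U₂)`. [folklore] -/
theorem coupling_integral_eq (hα : 0 < α) {U U' U₂ : ℝ → ℝ} {ω ψ V : ℝ → ℂ} {KU K₂ C : ℝ}
    (hU : ∀ y, HasDerivAt U (U' y) y) (hU' : ∀ y, HasDerivAt U' (U₂ y) y) (hUb : ∀ y, |U y| ≤ KU)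
    (hU₂c : Continuous U₂) (hU₂b : ∀ y, |U₂ y| ≤ K₂) (iU₂ : Integrable U₂)
    (hωc : Continuous ω) (hωb : ∀ y, ‖ω y‖ ≤ C) (iω : Integrable ω)
    (hψ : ψ = fun y => (2 * (α : ℂ))⁻¹ * ∫ s, ((Real.exp (-(α * |y - s|)) : ℝ) : ℂ) * ω s)
    (hV : V = fun y => (2 * (α : ℂ))⁻¹ * ∫ s, ((Real.exp (-(α * |y - s|)) : ℝ) : ℂ) * (U s : ℂ)) :
    ∫ y, ((U y : ℂ) * ω y + (U₂ y : ℂ) * ψ y) = (α : ℂ) ^ 2 * ∫ y, V y * ω y := by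
  have hUc : Continuous U := continuous_iff_continuousAt.2 fun y => (hU y).continuousAt
  have hUcc : Continuous fun y => (U y : ℂ) := by fun_prop
  have hU₂cc : Continuous fun y => (U₂ y : ℂ) := by fun_prop
  have hUcb : ∀ y, ‖(U y : ℂ)‖ ≤ KU := fun y => by rw [Complex.norm_real, Real.norm_eq_abs]; exact hUb y
  have hU₂cb : ∀ y, ‖(U₂ y : ℂ)‖ ≤ K₂ := fun y => by rw [Complex.norm_real, Real.norm_eq_abs]; exact hU₂b y
  -- Fubini
  have hfub := integral_mul_green_comm hα (φ := ω) (g := fun y => (U₂ y : ℂ)) iω hU₂cc hU₂cb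
  -- `T(U₂) = α² V − U`
  set F : ℝ → ℂ := fun y => (α : ℂ) ^ 2 * (U y : ℂ) + (-1) * (U₂ y : ℂ) with hF
  have hFc : Continuous F := by simp only [hF]; fun_prop
  have hFb : ∀ y, ‖F y‖ ≤ α ^ 2 * KU + K₂ := fun y => by
    simp only [hF]
    refine (norm_add_le _ _).trans (add_le_add ?_ ?_)
    · rw [norm_mul, norm_pow, Complex.norm_real, Real.norm_of_nonneg hα.le]
      exact mul_le_mul_of_nonneg_left (hUcb y) (by positivity)
    · rw [norm_mul, norm_neg, norm_one, one_mul]; exact hU₂cb y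
  have hUg : ∀ y, HasDerivAt (fun u => (U u : ℂ)) ((U' y : ℝ) : ℂ) y := fun y => (hU y).ofReal_comp
  have hUg' : ∀ y, HasDerivAt (fun u => (U' u : ℂ)) ((α : ℂ) ^ 2 * (U y : ℂ) - F y) y := fun y =>
    (hU' y).ofReal_comp.congr_deriv (by simp only [hF]; ring)
  have hUT := eq_green_of_bounded hα hFc hFb rfl hUg hUg' hUcb
  have hTU₂ : ∀ s, (2 * (α : ℂ))⁻¹ * ∫ y, ((Real.exp (-(α * |s - y|)) : ℝ) : ℂ) * (U₂ y : ℂ) =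
      (α : ℂ) ^ 2 * V s - (U s : ℂ) := by
    intro s
    have h := congrFun hUT s
    simp only [hF] at h
    rw [green_linear hα hUcc hUcb hU₂cc hU₂cb] at h
    rw [hV]
    simp only
    linear_combination h
  simp_rw [hTU₂] at hfub
  -- assemble
  have i1 : Integrable fun y => (U y : ℂ) * ω y :=
    iω.bdd_mul (c := KU) hUcc.aestronglyMeasurable (Eventually.of_forall hUcb)
  have hψb : ∀ y, ‖ψ y‖ ≤ C / α ^ 2 := green_norm_le hα hωc hωb hψ
  have hψc : Continuous ψ := green_continuous hα hωc hωb hψ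
  have i2 : Integrable fun y => (U₂ y : ℂ) * ψ y :=
    (iU₂.ofReal (𝕜 := ℂ)).mul_bdd hψc.aestronglyMeasurable (Eventually.of_forall hψb)
  have hVc : Continuous V := green_continuous hα hUcc hUcb hV
  have hVb : ∀ y, ‖V y‖ ≤ KU / α ^ 2 := green_norm_le hα hUcc hUcb hV
  have i3 : Integrable fun y => V y * ω y :=
    iω.bdd_mul (c := KU / α ^ 2) hVc.aestronglyMeasurable (Eventually.of_forall hVb)
  have i3' : Integrable fun y => (α : ℂ) ^ 2 * V y * ω y := by
    have := i3.const_mul ((α : ℂ) ^ 2); exact this.congr (Eventually.of_forall fun y => by simp only; ring)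
  have hψ' : ∫ y, (U₂ y : ℂ) * ψ y = ∫ s, ((α : ℂ) ^ 2 * V s - (U s : ℂ)) * ω s := by subst hψ; exact hfub
  rw [integral_add i1 i2, hψ']
  have hsplit : ∫ s, ((α : ℂ) ^ 2 * V s - (U s : ℂ)) * ω s = (∫ s, (α : ℂ) ^ 2 * V s * ω s) - ∫ s, (U s : ℂ) * ω s := by
    rw [← integral_sub i3' i1]; congr 1; funext s; ring
  rw [hsplit, ← integral_const_mul]
  have : ∫ s, (α : ℂ) ^ 2 * V s * ω s = ∫ s, (α : ℂ) ^ 2 * (V s * ω s) := by congr 1; funext s; ring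
  rw [this]; ring

end Mass

end Summit.AnomalousDissipation.AnomalousDissipation.Theorems.MarginalStabilityChainBurgersLayerLowRe
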